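import Summits.PneNP.PneNP.Theses.ConvexRankGates
import Literature.Computability.Complexity.ExtMonotoneCircuits

/-! Scratch checks for crux-triage stmt-PneNP-2659 (Capture), triager r1-1. -/

namespace CruxTriage

open Literature.Computability.Complexity

/-- (0) the crux elaborates (identity probe, no sorry). -/
example (h : Summit.PneNP.PneNP.Theses.ConvexRankGates.Capture) :
    Summit.PneNP.PneNP.Theses.ConvexRankGates.Capture := h

/-- (1) budget-banding, horn A: there is NO monotone "merge" gadget, uniform in `f`, that recovers a
monotone `f` from its Berkowitz slices `f₀,f₁` and the input — already for ONE variable.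
Slices of `f : Bool → Bool`: `f₀ x = (x = 0 → f 0; else 1)`, `f₁ x = (x = 0 → 0; else f 1)`.
A merge `M (f₀ x) (f₁ x) x` monotone in its three arguments and correct for all four monotone… in fact
for the two constant functions `f ≡ 0`, `f ≡ 1` alone is impossible:
`f ≡ 1` at `x = 0` forces `M 1 0 0 = 1`; `f ≡ 0` at `x = 1` forces `M 1 0 1 = 0`; monotonicity in `x` fails. -/
theorem no_uniform_monotone_slice_merge :
    ¬ ∃ M : Bool → Bool → Bool → Bool,
      (∀ a b c c', c ≤ c' → M a b c ≤ M a b c') ∧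
      (∀ f : Bool → Bool, Monotone f →
        ∀ x : Bool, f x = M (if x then true else f false) (if x then f true else false) x) := by
  rintro ⟨M, hmono, hmerge⟩
  have h1 : M true false false = true := by
    simpa using (hmerge (fun _ => true) (fun _ _ _ => le_rfl) false).symm
  have h0 : M true false true = false := by
    simpa using (hmerge (fun _ => false) (fun _ _ _ => le_rfl) true).symm
  have key := hmono true false false true (by decide)
  rw [h1, h0] at key
  exact absurd key (by decide)

/-- (2) valiant-shadow, naive version: the formal arithmetisation of a B2-circuit computing a monotone
function need NOT have support-shadow equal to the function. `f(x₁,x₂) = x₁` computed as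
`x₁ ∨ (x₂ ∧ ¬x₂)` with `OR ↦ a+b-ab`, `AND ↦ ab`, `NOT ↦ 1-a` arithmetises to
`P = x₁ + (x₂ - x₂²) - x₁ (x₂ - x₂²)`; killing `x₁` leaves `x₂ - x₂² ≠ 0` (value `-2` at `x₂ = 2`), so the
shadow accepts `{2}` although `f(0,1) = 0`. -/
example : (fun x₁ x₂ : ℤ => x₁ + (x₂ - x₂ ^ 2) - x₁ * (x₂ - x₂ ^ 2)) 0 2 ≠ 0 := by decide

/-- (3) every circuit over the extended basis computes a monotone function (tree), so any merge of
band-slices built from Ext gates is itself a monotone gadget and (1) applies to it. -/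
example {ι : Type*} (C : Circuit ι) (s : ℕ) (h : C.IsOver (extGate s)) : Monotone C.eval :=
  C.monotone_eval_of_isOver_extGate h

end CruxTriage

namespace CruxTriage

/-- Hamming-weight threshold `Th_t` on `n` variables. -/
def thrB (n t : ℕ) (x : Fin n → Bool) : Bool :=
  decide (t ≤ (Finset.univ.filter fun i => x i = true).card)

/-- lower ends of the dyadic bands `{0}, {1}, [2,4), [4,8), …`: `a 0 = 0`, `a (j+1) = 2^j`. -/
def bandLo : ℕ → ℕ
  | 0 => 0
  | j + 1 => 2 ^ j

/-- the two-sided band-slice of `f` for dyadic band `j`: `0` below the band, `f` on it, `1` above. -/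
def bandSlice (n : ℕ) (f : (Fin n → Bool) → Bool) (j : ℕ) (x : Fin n → Bool) : Bool :=
  (f x && thrB n (bandLo j) x) || thrB n (bandLo (j + 1)) x

/-- (1') budget-banding, horn A for EVERY `n ≥ 1` and the dyadic banding: no gadget `M`, monotone in the
input `x` (as every Ext-circuit is) and uniform in `f`, recovers `f` from its dyadic band-slices and `x`:
compare `f ≡ 1` at `x = 0⃗` (band 0) with `f ≡ 0` at `x = e₀` (band 1) — identical slice vectors, `0⃗ ≤ e₀`. -/
theorem no_uniform_monotone_band_merge (n : ℕ) (hn : 1 ≤ n) :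
    ¬ ∃ M : (ℕ → Bool) → (Fin n → Bool) → Bool,
      (∀ F x x', x ≤ x' → M F x ≤ M F x') ∧
      (∀ f : (Fin n → Bool) → Bool, Monotone f → ∀ x, f x = M (fun j => bandSlice n f j x) x) := by
  rintro ⟨M, hmono, hmerge⟩
  set z : Fin n → Bool := fun _ => false with hz
  set e : Fin n → Bool := fun i => decide (i = ⟨0, hn⟩) with he
  have hze : z ≤ e := fun i => by simp [hz]
  -- weights
  have wz : (Finset.univ.filter fun i => z i = true).card = 0 := by simp [hz]
  have we : (Finset.univ.filter fun i => e i = true).card = 1 := by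
    rw [Finset.card_eq_one]
    exact ⟨⟨0, hn⟩, by ext i; simp [he]⟩
  -- slice vectors coincide
  have hvec : (fun j => bandSlice n (fun _ => true) j z) = (fun j => bandSlice n (fun _ => false) j e) := by
    funext j
    cases j with
    | zero => simp [bandSlice, thrB, bandLo, we]
    | succ j =>
      simp only [bandSlice, thrB, bandLo, wz, we, Bool.true_and, Bool.false_and, Bool.false_or]
      have h1 : ¬ 2 ^ j ≤ 0 := by
        have : 0 < 2 ^ j := Nat.pos_of_ne_zero (by simp)
        omega
      have h2 : ¬ 2 ^ (j + 1) ≤ 0 := by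
        have : 0 < 2 ^ (j + 1) := Nat.pos_of_ne_zero (by simp)
        omega
      have h3 : ¬ 2 ^ (j + 1) ≤ 1 := by
        have : 2 ≤ 2 ^ (j + 1) := by
          calc 2 = 2 ^ 1 := by norm_num
            _ ≤ 2 ^ (j + 1) := Nat.pow_le_pow_right (by norm_num) (by omega)
        omega
      simp [h1, h2, h3]
  have h1 : M (fun j => bandSlice n (fun _ => true) j z) z = true :=
    (hmerge (fun _ => true) (fun _ _ _ => le_rfl) z).symm
  have h0 : M (fun j => bandSlice n (fun _ => false) j e) e = false :=
    (hmerge (fun _ => false) (fun _ _ _ => le_rfl) e).symm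
  have key := hmono (fun j => bandSlice n (fun _ => true) j z) z e hze
  rw [h1, hvec, h0] at key
  exact absurd key (by decide)

end CruxTriage
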